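import Mathlib
import Summits.NavierStokesRegularity.NavierStokesRegularity.Theorems.FilamentSkeletonRssClause13FarOperatorSup
import Summits.NavierStokesRegularity.NavierStokesRegularity.Theorems.FilamentSkeletonRssClause13FarTailSup
import Summits.NavierStokesRegularity.NavierStokesRegularity.Theorems.FilamentSkeletonRssClause13TwoZoneFence

/-!
# Clause 13-J/13-R, brick m3b ASSEMBLY (MODEL FAR PART, POINTWISE): the far piece `Y_H = Y − k∗Y` of the 1-D model near the waist

Route `FilamentSkeletonRss`, ∃-side clause 13 (`Clause13RNearStraightL`, stmt-NavierStokesRegularity-23612; typing-agnostic).  Design of record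
rev 80–82 (NOT DECOMPOSED YET: m3b = director default (ii) + tenure notes R-m3b-1…3; lane g17 successor step (2) "composition waist → damped →
amplified into ONE pointwise statement for the model's far part").  For the model operator `𝓛Y = iG((2/q)Y − K_q∗Y) − wY′ + β₁Y + β₂conj Y`, a near
kernel `k` (real `C¹`, bounded, `k, t k, t²k′ ∈ L¹`, profile `χ = 1` unless `X ≤ |z|√q`) and `Y ∈ C¹_c`, the far piece `Y_H = Y − k∗Y` solves the
lab-frame transport ODE `w·Y_H′ = i(2G/q)Y_H + β₁Y_H + β₂conj Y_H + f` (`far_transport_ode`, p717403) whose forcing is bounded IN SUP NORM by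
  `M_H = G·ε_X(1+‖k‖₁)·N(Y) + (1+‖k‖₁)·S_L + Λ·S_T + (Λ₂(‖t²k′‖₁+‖t k‖₁) + (L₁+L₂)‖t k‖₁)·S_Y`,  `ε_X = (10/(q√(π√q)))e^{−X/2}`
(`norm_modelOperator_far_le` p717403, `norm_smoothingPiece_far_le` p717741; `S_L ≥ sup‖𝓛Y‖`, `S_Y ≥ sup‖Y‖`, `S_T ≥ sup‖P_T‖` on the zone,
`P_T = (t k′+k)∗Y` the transition piece — bounded through the window gain in `…Clause13WindowPieceSup`).  Feeding this into the two-zone chain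
`twoZone_norm_le_var` (`…Clause13TwoZoneFence`) gives
* §1 `norm_far_forcing_le_sup` — `‖f(x)‖ ≤ M_H` at every `x` of the zone;
* §2 ★ `model_far_pointwise_right` — on `[c, c+…]`: with `k₂ = b₂q/(4G) ≤ ½`, `K = ((1+k₂)/β₀)/(1−k₂)`, under the pointwise damping margin on
  `[c, d]` (`β₀ ≤ −Re β₁ − (k₂/(1−k₂))(2|Im β₁| + k₂‖β₂‖) − w‖β₂′‖/((4G/q)(1−k₂))`, `β₀ ≤ 2G/q − ‖β₁(c)‖ − ‖β₂(c)‖`) and the growth condition on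
  `[d, b]` (`Re β₁ + β₀ + … ≤ p·w₁`, `w ≥ w₁(τ−c)`):  `‖Y_H(τ)‖ ≤ K·M_H` on `[c, d]` and `‖Y_H(τ)‖ ≤ ((τ−c)/(d−c))^p·K·(β₀K·M_H)` on `[d, b]`;
* §3 ★ `model_far_pointwise_left` — the mirror statement on `[b, c]` (zones `[e, c]`, `[b, e]`; `w < 0` on `[b, c)`, `−w ≥ w₁(c−τ)`).
MODEL currency (honest label, cf. memo add1 / rev 81): `N(Y)`, `S_L = sup_ℝ‖𝓛Y‖` and `S_Y` sit on the right; the exchange to the clause's in-ball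
pointwise currency ((I)/(II)/(III)) is the booked waist-localisation design point and is NOT done here.  In the class `½w′ + Re β₁ ≡ ¾` one has
`Re β₁ = ¾ − ½w′`: `−δ/2` at the waist (damped zone exists by supercriticality) and `→ ½` far out (amplified zone, exponent `p`).
Lane ns-filament-19175-p1 g18; `--supports stmt-NavierStokesRegularity-23612 --as helper`.
HONEST FRAMING: an a-priori sup estimate for an explicit 1-D model operator attached to a HYPOTHETICAL filament skeleton on the NEGATIVE side of a
MODEL route; nothing here bears on Navier–Stokes regularity or blow-up; 23610/23612 stay OPEN.
-/

noncomputable section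

open MeasureTheory Real Complex Filter Set
open scoped ComplexConjugate Topology
open Summit.NavierStokesRegularity.NavierStokesRegularity.Theorems.Clause13Transport (twoZone_norm_le_var twoZone_norm_le_var_left)

namespace Summit.NavierStokesRegularity.NavierStokesRegularity.Theorems.MatchedKernel
set_option linter.dupNamespace false

/-! ## §1 The forcing of the far transport ODE in sup norm -/

/-- **SUP BOUND OF THE FAR FORCING.**  `f(x) = −iG·(K_q∗Y_H)(x) − (𝓛Y_H)(x)` satisfies, at every `x` where `‖P_T(x)‖ ≤ S_T`,
`‖f(x)‖ ≤ G·ε_X(1+‖k‖₁)N(Y) + (1+‖k‖₁)S_L + Λ·S_T + (Λ₂(‖t²k′‖₁+‖t k‖₁) + (L₁+L₂)‖t k‖₁)S_Y`, `ε_X = (10/(q√(π√q)))e^{−X/2}`. [folklore] -/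
theorem norm_far_forcing_le_sup {q G X : ℝ} (hq : 0 < q) (hG : 0 < G) (hX : 0 < X)
    {k k' : ℝ → ℝ} (hk : ∀ t, HasDerivAt k (k' t) t) (hk'c : Continuous k')
    (hki : Integrable k) (hk1 : Integrable fun t => t * k t) (hk'2 : Integrable fun t => t ^ 2 * k' t) {Mk : ℝ} (hkM : ∀ t, |k t| ≤ Mk)
    {χ : ℝ → ℂ} (hkχ : ∀ z : ℝ, ∫ t : ℝ, ((k t : ℝ) : ℂ) * cexp (I * z * t) = χ z) (hfar : ∀ z : ℝ, χ z ≠ 1 → X ≤ |z| * √q)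
    {Y : ℝ → ℂ} (hY : ContDiff ℝ 1 Y) (hYs : HasCompactSupport Y)
    {w : ℝ → ℝ} (hw : Differentiable ℝ w) (hw2 : Differentiable ℝ (deriv w)) {Λ Λ₂ : ℝ} (hΛ : ∀ t, |deriv w t| ≤ Λ)
    (hΛ₂ : ∀ t, |deriv (deriv w) t| ≤ Λ₂)
    {β₁ β₂ : ℝ → ℂ} (hβ₁c : Continuous β₁) (hβ₂c : Continuous β₂) {b₁ b₂ L₁ L₂ : ℝ}
    (hb₁ : ∀ τ, ‖β₁ τ‖ ≤ b₁) (hb₂ : ∀ τ, ‖β₂ τ‖ ≤ b₂) (hL₁ : ∀ x y, ‖β₁ y - β₁ x‖ ≤ L₁ * |y - x|)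
    (hL₂ : ∀ x y, ‖β₂ y - β₂ x‖ ≤ L₂ * |y - x|)
    {SL SY ST : ℝ}
    (hSL : ∀ y : ℝ, ‖I * (G : ℂ) * ((2 / q : ℂ) * Y y
          - ∫ σ : ℝ, ((((2 * q - (y - σ) ^ 2) * (((y - σ) ^ 2 + q) ^ (5 / 2 : ℝ))⁻¹ : ℝ)) : ℂ) * Y σ)
        - ((w y : ℝ) : ℂ) * deriv Y y + β₁ y * Y y + β₂ y * conj (Y y)‖ ≤ SL)
    (hSY : ∀ y : ℝ, ‖Y y‖ ≤ SY) {x : ℝ}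
    (hST : ‖∫ y : ℝ, (((x - y) * k' (x - y) + k (x - y) : ℝ) : ℂ) * Y y‖ ≤ ST) :
    ‖-(I * (G : ℂ) * ∫ σ : ℝ, ((((2 * q - (x - σ) ^ 2) * (((x - σ) ^ 2 + q) ^ (5 / 2 : ℝ))⁻¹ : ℝ)) : ℂ)
              * (Y σ - ∫ y : ℝ, ((k (σ - y) : ℝ) : ℂ) * Y y))
        - (I * (G : ℂ) * ((2 / q : ℂ) * (Y x - ∫ y : ℝ, ((k (x - y) : ℝ) : ℂ) * Y y)
            - ∫ σ : ℝ, ((((2 * q - (x - σ) ^ 2) * (((x - σ) ^ 2 + q) ^ (5 / 2 : ℝ))⁻¹ : ℝ)) : ℂ)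
                * (Y σ - ∫ y : ℝ, ((k (σ - y) : ℝ) : ℂ) * Y y))
          - ((w x : ℝ) : ℂ) * (deriv Y x - ∫ y : ℝ, ((k (x - y) : ℝ) : ℂ) * deriv Y y)
          + β₁ x * (Y x - ∫ y : ℝ, ((k (x - y) : ℝ) : ℂ) * Y y) + β₂ x * conj (Y x - ∫ y : ℝ, ((k (x - y) : ℝ) : ℂ) * Y y))‖
      ≤ G * (10 / (q * Real.sqrt (π * √q)) * Real.exp (-(X / 2)) * (1 + ∫ t, |k t|) * (∫ x : ℝ, ‖Y x‖ ^ 2) ^ (1 / 2 : ℝ))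
        + ((1 + ∫ t, |k t|) * SL + Λ * ST
          + (Λ₂ * ((∫ t, t ^ 2 * |k' t|) + (∫ t, |t| * |k t|)) + (L₁ + L₂) * (∫ t, |t| * |k t|)) * SY) := by
  have hkc : Continuous k := continuous_iff_continuousAt.2 fun t => (hk t).continuousAt
  have hΛ0 : 0 ≤ Λ := (abs_nonneg _).trans (hΛ 0)
  have htail := (norm_smoothingPiece_far_le hq hX hkc hki hkM hkχ hfar hY hYs x).2
  have hop := norm_modelOperator_far_le (G := G) hq hk hk'c hki hk1 hk'2 hkM hY hYs hw hw2 hΛ hΛ₂ hβ₁c hβ₂c hb₁ hb₂ hL₁ hL₂ hSL hSY x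
  refine (norm_far_forcing_le hG.le _ _).trans ?_
  have h1 := mul_le_mul_of_nonneg_left htail hG.le
  have h2 : (1 + ∫ t, |k t|) * SL + Λ * ‖∫ y : ℝ, (((x - y) * k' (x - y) + k (x - y) : ℝ) : ℂ) * Y y‖
        + (Λ₂ * ((∫ t, t ^ 2 * |k' t|) + (∫ t, |t| * |k t|)) + (L₁ + L₂) * (∫ t, |t| * |k t|)) * SY
      ≤ (1 + ∫ t, |k t|) * SL + Λ * ST
        + (Λ₂ * ((∫ t, t ^ 2 * |k' t|) + (∫ t, |t| * |k t|)) + (L₁ + L₂) * (∫ t, |t| * |k t|)) * SY := by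
    have := mul_le_mul_of_nonneg_left hST hΛ0
    linarith
  linarith [hop.trans h2]

/-! ## §2 The far piece near the waist: two zones, right side -/

/-- ★ **MODEL FAR PART, POINTWISE, RIGHT SIDE OF THE WAIST.**  See the module docstring.  Data: `q, G, X > 0`; `k` (near kernel: real `C¹`,
bounded, `k, t k, t²k′ ∈ L¹`, profile `= 1` unless `X ≤ |z|√q`); `Y ∈ C¹_c`; `w ∈ C²` (`|w′| ≤ Λ`, `|w″| ≤ Λ₂`), `w(c) = 0`, `w > 0` on `(c, b]`,
`w ≥ w₁(τ−c)` on `[d, b]` (`c < d ≤ b`, `w₁ > 0`); `β₁` continuous, `‖β₁‖ ≤ b₁`, `L₁`-Lipschitz; `β₂ ∈ C¹`, `‖β₂‖ ≤ b₂ ≤ 2G/q`, `‖β₂′‖`-term in the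
margins, `L₂`-Lipschitz; sup data `S_L, S_Y, S_T`; the damping margin on `[c, d]`, the waist inequality, the growth condition on `[d, b]` (rotation
rate `2G/q`, `k₂ = b₂/(2·(2G/q))`).  Conclusion: with `M_H` as in `norm_far_forcing_le_sup` and `K = ((1+k₂)/β₀)/(1−k₂)`,
`‖Y_H(τ)‖ ≤ K·M_H` on `[c, d]` and `‖Y_H(τ)‖ ≤ ((τ−c)/(d−c))^p·K·(β₀K·M_H)` on `[d, b]`. [folklore] -/
theorem model_far_pointwise_right {q G X : ℝ} (hq : 0 < q) (hG : 0 < G) (hX : 0 < X)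
    {k k' : ℝ → ℝ} (hk : ∀ t, HasDerivAt k (k' t) t) (hk'c : Continuous k')
    (hki : Integrable k) (hk1 : Integrable fun t => t * k t) (hk'2 : Integrable fun t => t ^ 2 * k' t) {Mk : ℝ} (hkM : ∀ t, |k t| ≤ Mk)
    {χ : ℝ → ℂ} (hkχ : ∀ z : ℝ, ∫ t : ℝ, ((k t : ℝ) : ℂ) * cexp (I * z * t) = χ z) (hfar : ∀ z : ℝ, χ z ≠ 1 → X ≤ |z| * √q)
    {Y : ℝ → ℂ} (hY : ContDiff ℝ 1 Y) (hYs : HasCompactSupport Y)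
    {w : ℝ → ℝ} (hw : Differentiable ℝ w) (hw2 : Differentiable ℝ (deriv w)) {Λ Λ₂ : ℝ} (hΛ : ∀ t, |deriv w t| ≤ Λ)
    (hΛ₂ : ∀ t, |deriv (deriv w) t| ≤ Λ₂) {c d b w₁ : ℝ} (hcd : c < d) (hdb : d ≤ b) (hw₁ : 0 < w₁)
    (hwc : w c = 0) (hwpos : ∀ τ ∈ Icc c b, c < τ → 0 < w τ) (hww₁ : ∀ τ ∈ Icc d b, w₁ * (τ - c) ≤ w τ)
    {β₁ β₂ β₂' : ℝ → ℂ} (hβ₁c : Continuous β₁) (hβ₂ : ∀ τ, HasDerivAt β₂ (β₂' τ) τ) {b₁ b₂ L₁ L₂ : ℝ}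
    (hb₁ : ∀ τ, ‖β₁ τ‖ ≤ b₁) (hb₂ : ∀ τ, ‖β₂ τ‖ ≤ b₂) (hL₁ : ∀ x y, ‖β₁ y - β₁ x‖ ≤ L₁ * |y - x|)
    (hL₂ : ∀ x y, ‖β₂ y - β₂ x‖ ≤ L₂ * |y - x|) (hsmall : b₂ ≤ 2 * G / q)
    {β₀ p : ℝ} (hβ₀ : 0 < β₀) (hp0 : 0 ≤ p)
    (hgain : ∀ τ ∈ Icc c d, β₀ ≤ -(β₁ τ).re
      - (b₂ / (2 * (2 * G / q))) / (1 - b₂ / (2 * (2 * G / q))) * (2 * |(β₁ τ).im| + b₂ / (2 * (2 * G / q)) * ‖β₂ τ‖)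
      - (w τ * ‖β₂' τ‖ / (2 * (2 * G / q))) / (1 - b₂ / (2 * (2 * G / q))))
    (hstag : β₀ ≤ 2 * G / q - ‖β₁ c‖ - ‖β₂ c‖)
    (hgrow : ∀ τ ∈ Icc d b, (β₁ τ).re + β₀
      + (b₂ / (2 * (2 * G / q))) / (1 - b₂ / (2 * (2 * G / q))) * (2 * |(β₁ τ).im| + b₂ / (2 * (2 * G / q)) * ‖β₂ τ‖)
      + (w τ * ‖β₂' τ‖ / (2 * (2 * G / q))) / (1 - b₂ / (2 * (2 * G / q))) ≤ p * w₁)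
    {SL SY ST : ℝ}
    (hSL : ∀ y : ℝ, ‖I * (G : ℂ) * ((2 / q : ℂ) * Y y
          - ∫ σ : ℝ, ((((2 * q - (y - σ) ^ 2) * (((y - σ) ^ 2 + q) ^ (5 / 2 : ℝ))⁻¹ : ℝ)) : ℂ) * Y σ)
        - ((w y : ℝ) : ℂ) * deriv Y y + β₁ y * Y y + β₂ y * conj (Y y)‖ ≤ SL)
    (hSY : ∀ y : ℝ, ‖Y y‖ ≤ SY)
    (hST : ∀ x ∈ Icc c b, ‖∫ y : ℝ, (((x - y) * k' (x - y) + k (x - y) : ℝ) : ℂ) * Y y‖ ≤ ST) :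
    (∀ τ ∈ Icc c d, ‖Y τ - ∫ y : ℝ, ((k (τ - y) : ℝ) : ℂ) * Y y‖
        ≤ ((1 + b₂ / (2 * (2 * G / q))) / β₀) / (1 - b₂ / (2 * (2 * G / q)))
          * (G * (10 / (q * Real.sqrt (π * √q)) * Real.exp (-(X / 2)) * (1 + ∫ t, |k t|) * (∫ x : ℝ, ‖Y x‖ ^ 2) ^ (1 / 2 : ℝ))
            + ((1 + ∫ t, |k t|) * SL + Λ * ST
              + (Λ₂ * ((∫ t, t ^ 2 * |k' t|) + (∫ t, |t| * |k t|)) + (L₁ + L₂) * (∫ t, |t| * |k t|)) * SY))) ∧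
    (∀ τ ∈ Icc d b, ‖Y τ - ∫ y : ℝ, ((k (τ - y) : ℝ) : ℂ) * Y y‖
        ≤ ((τ - c) / (d - c)) ^ p *
          ((((1 + b₂ / (2 * (2 * G / q))) / β₀) / (1 - b₂ / (2 * (2 * G / q)))) *
            ((β₀ * (((1 + b₂ / (2 * (2 * G / q))) / β₀) / (1 - b₂ / (2 * (2 * G / q))))) *
              (G * (10 / (q * Real.sqrt (π * √q)) * Real.exp (-(X / 2)) * (1 + ∫ t, |k t|) * (∫ x : ℝ, ‖Y x‖ ^ 2) ^ (1 / 2 : ℝ))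
                + ((1 + ∫ t, |k t|) * SL + Λ * ST
                  + (Λ₂ * ((∫ t, t ^ 2 * |k' t|) + (∫ t, |t| * |k t|)) + (L₁ + L₂) * (∫ t, |t| * |k t|)) * SY))))) := by
  have hkc : Continuous k := continuous_iff_continuousAt.2 fun t => (hk t).continuousAt
  have hβ₂c : Continuous β₂ := continuous_iff_continuousAt.2 fun t => (hβ₂ t).continuousAt
  have hGq : 0 < 2 * G / q := by positivity
  have hb20 : 0 ≤ b₂ := (norm_nonneg _).trans (hb₂ 0)
  have hΛ0 : 0 ≤ Λ := (abs_nonneg _).trans (hΛ 0)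
  have hc : c ∈ Icc c b := left_mem_Icc.2 (hcd.le.trans hdb)
  -- the far piece, its derivative, the ODE and its forcing
  set z : ℝ → ℂ := fun x => Y x - ∫ y : ℝ, ((k (x - y) : ℝ) : ℂ) * Y y with hzdef
  set z' : ℝ → ℂ := fun x => deriv Y x - ∫ y : ℝ, ((k (x - y) : ℝ) : ℂ) * deriv Y y with hz'def
  set f : ℝ → ℂ := fun x =>
    (-(I * (G : ℂ) * ∫ σ : ℝ, ((((2 * q - (x - σ) ^ 2) * (((x - σ) ^ 2 + q) ^ (5 / 2 : ℝ))⁻¹ : ℝ)) : ℂ)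
              * (Y σ - ∫ y : ℝ, ((k (σ - y) : ℝ) : ℂ) * Y y))
        - (I * (G : ℂ) * ((2 / q : ℂ) * (Y x - ∫ y : ℝ, ((k (x - y) : ℝ) : ℂ) * Y y)
            - ∫ σ : ℝ, ((((2 * q - (x - σ) ^ 2) * (((x - σ) ^ 2 + q) ^ (5 / 2 : ℝ))⁻¹ : ℝ)) : ℂ)
                * (Y σ - ∫ y : ℝ, ((k (σ - y) : ℝ) : ℂ) * Y y))
          - ((w x : ℝ) : ℂ) * (deriv Y x - ∫ y : ℝ, ((k (x - y) : ℝ) : ℂ) * deriv Y y)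
          + β₁ x * (Y x - ∫ y : ℝ, ((k (x - y) : ℝ) : ℂ) * Y y) + β₂ x * conj (Y x - ∫ y : ℝ, ((k (x - y) : ℝ) : ℂ) * Y y))) with hfdef
  have hz : ∀ τ ∈ Icc c b, HasDerivAt z (z' τ) τ := fun τ _ => hasDerivAt_far hkc hY hYs τ
  have hode : ∀ τ ∈ Icc c b, (w τ : ℂ) * z' τ = I * ((2 * G / q : ℝ) : ℂ) * z τ + β₁ τ * z τ + β₂ τ * conj (z τ) + f τ :=
    fun τ _ => far_transport_ode q G hq k Y w β₁ β₂ τ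
  set MH : ℝ := G * (10 / (q * Real.sqrt (π * √q)) * Real.exp (-(X / 2)) * (1 + ∫ t, |k t|) * (∫ x : ℝ, ‖Y x‖ ^ 2) ^ (1 / 2 : ℝ))
        + ((1 + ∫ t, |k t|) * SL + Λ * ST
          + (Λ₂ * ((∫ t, t ^ 2 * |k' t|) + (∫ t, |t| * |k t|)) + (L₁ + L₂) * (∫ t, |t| * |k t|)) * SY) with hMH
  have hf : ∀ τ ∈ Icc c b, ‖f τ‖ ≤ MH := fun τ hτ =>
    norm_far_forcing_le_sup hq hG hX hk hk'c hki hk1 hk'2 hkM hkχ hfar hY hYs hw hw2 hΛ hΛ₂ hβ₁c hβ₂c hb₁ hb₂ hL₁ hL₂ hSL hSY (hST τ hτ)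
  have hMH0 : 0 ≤ MH := (norm_nonneg _).trans (hf c hc)
  -- the two-zone chain with rotation rate `2G/q`
  have hwpos' : ∀ τ ∈ Ioc c b, 0 < w τ := fun τ hτ => hwpos τ ⟨hτ.1.le, hτ.2⟩ hτ.1
  have h := twoZone_norm_le_var (z := z) (z' := z') (f := f) (α := β₁) (β := β₂) (β' := β₂') (G := 2 * G / q) (βmax := b₂)
    hGq hMH0 hβ₀ hb20 hcd hdb hw₁ hp0 hz (fun τ _ => hβ₂ τ) hw.continuous hwc hwpos' hww₁ hode hf (fun τ _ => hb₂ τ) hsmall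
    hgain hstag hgrow
  exact h

/-! ## §3 The far piece near the waist: two zones, left side -/

/-- ★ **MODEL FAR PART, POINTWISE, LEFT SIDE OF THE WAIST** (mirror of `model_far_pointwise_right`: `w < 0` on `[b, c)`, zones `[e, c]` and
`[b, e]` with `−w ≥ w₁(c−τ)`, variation terms with `−w`; via `twoZone_norm_le_var_left`).  See the module docstring.  Data: `q, G, X > 0`; `k` (near kernel: real `C¹`,
bounded, `k, t k, t²k′ ∈ L¹`, profile `= 1` unless `X ≤ |z|√q`); `Y ∈ C¹_c`; `w ∈ C²` (`|w′| ≤ Λ`, `|w″| ≤ Λ₂`), `w(c) = 0`, `w > 0` on `(c, b]`,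
`w ≥ w₁(τ−c)` on `[d, b]` (`c < d ≤ b`, `w₁ > 0`); `β₁` continuous, `‖β₁‖ ≤ b₁`, `L₁`-Lipschitz; `β₂ ∈ C¹`, `‖β₂‖ ≤ b₂ ≤ 2G/q`, `‖β₂′‖`-term in the
margins, `L₂`-Lipschitz; sup data `S_L, S_Y, S_T`; the damping margin on `[c, d]`, the waist inequality, the growth condition on `[d, b]` (rotation
rate `2G/q`, `k₂ = b₂/(2·(2G/q))`).  Conclusion: with `M_H` as in `norm_far_forcing_le_sup` and `K = ((1+k₂)/β₀)/(1−k₂)`,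
`‖Y_H(τ)‖ ≤ K·M_H` on `[c, d]` and `‖Y_H(τ)‖ ≤ ((τ−c)/(d−c))^p·K·(β₀K·M_H)` on `[d, b]`. [folklore] -/
theorem model_far_pointwise_left {q G X : ℝ} (hq : 0 < q) (hG : 0 < G) (hX : 0 < X)
    {k k' : ℝ → ℝ} (hk : ∀ t, HasDerivAt k (k' t) t) (hk'c : Continuous k')
    (hki : Integrable k) (hk1 : Integrable fun t => t * k t) (hk'2 : Integrable fun t => t ^ 2 * k' t) {Mk : ℝ} (hkM : ∀ t, |k t| ≤ Mk)
    {χ : ℝ → ℂ} (hkχ : ∀ z : ℝ, ∫ t : ℝ, ((k t : ℝ) : ℂ) * cexp (I * z * t) = χ z) (hfar : ∀ z : ℝ, χ z ≠ 1 → X ≤ |z| * √q)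
    {Y : ℝ → ℂ} (hY : ContDiff ℝ 1 Y) (hYs : HasCompactSupport Y)
    {w : ℝ → ℝ} (hw : Differentiable ℝ w) (hw2 : Differentiable ℝ (deriv w)) {Λ Λ₂ : ℝ} (hΛ : ∀ t, |deriv w t| ≤ Λ)
    (hΛ₂ : ∀ t, |deriv (deriv w) t| ≤ Λ₂) {c e b w₁ : ℝ} (hec : e < c) (hbe : b ≤ e) (hw₁ : 0 < w₁)
    (hwc : w c = 0) (hwneg : ∀ τ ∈ Icc b c, τ < c → w τ < 0) (hww₁ : ∀ τ ∈ Icc b e, w₁ * (c - τ) ≤ -w τ)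
    {β₁ β₂ β₂' : ℝ → ℂ} (hβ₁c : Continuous β₁) (hβ₂ : ∀ τ, HasDerivAt β₂ (β₂' τ) τ) {b₁ b₂ L₁ L₂ : ℝ}
    (hb₁ : ∀ τ, ‖β₁ τ‖ ≤ b₁) (hb₂ : ∀ τ, ‖β₂ τ‖ ≤ b₂) (hL₁ : ∀ x y, ‖β₁ y - β₁ x‖ ≤ L₁ * |y - x|)
    (hL₂ : ∀ x y, ‖β₂ y - β₂ x‖ ≤ L₂ * |y - x|) (hsmall : b₂ ≤ 2 * G / q)
    {β₀ p : ℝ} (hβ₀ : 0 < β₀) (hp0 : 0 ≤ p)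
    (hgain : ∀ τ ∈ Icc e c, β₀ ≤ -(β₁ τ).re
      - (b₂ / (2 * (2 * G / q))) / (1 - b₂ / (2 * (2 * G / q))) * (2 * |(β₁ τ).im| + b₂ / (2 * (2 * G / q)) * ‖β₂ τ‖)
      - (-w τ * ‖β₂' τ‖ / (2 * (2 * G / q))) / (1 - b₂ / (2 * (2 * G / q))))
    (hstag : β₀ ≤ 2 * G / q - ‖β₁ c‖ - ‖β₂ c‖)
    (hgrow : ∀ τ ∈ Icc b e, (β₁ τ).re + β₀
      + (b₂ / (2 * (2 * G / q))) / (1 - b₂ / (2 * (2 * G / q))) * (2 * |(β₁ τ).im| + b₂ / (2 * (2 * G / q)) * ‖β₂ τ‖)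
      + (-w τ * ‖β₂' τ‖ / (2 * (2 * G / q))) / (1 - b₂ / (2 * (2 * G / q))) ≤ p * w₁)
    {SL SY ST : ℝ}
    (hSL : ∀ y : ℝ, ‖I * (G : ℂ) * ((2 / q : ℂ) * Y y
          - ∫ σ : ℝ, ((((2 * q - (y - σ) ^ 2) * (((y - σ) ^ 2 + q) ^ (5 / 2 : ℝ))⁻¹ : ℝ)) : ℂ) * Y σ)
        - ((w y : ℝ) : ℂ) * deriv Y y + β₁ y * Y y + β₂ y * conj (Y y)‖ ≤ SL)
    (hSY : ∀ y : ℝ, ‖Y y‖ ≤ SY)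
    (hST : ∀ x ∈ Icc b c, ‖∫ y : ℝ, (((x - y) * k' (x - y) + k (x - y) : ℝ) : ℂ) * Y y‖ ≤ ST) :
    (∀ τ ∈ Icc e c, ‖Y τ - ∫ y : ℝ, ((k (τ - y) : ℝ) : ℂ) * Y y‖
        ≤ ((1 + b₂ / (2 * (2 * G / q))) / β₀) / (1 - b₂ / (2 * (2 * G / q)))
          * (G * (10 / (q * Real.sqrt (π * √q)) * Real.exp (-(X / 2)) * (1 + ∫ t, |k t|) * (∫ x : ℝ, ‖Y x‖ ^ 2) ^ (1 / 2 : ℝ))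
            + ((1 + ∫ t, |k t|) * SL + Λ * ST
              + (Λ₂ * ((∫ t, t ^ 2 * |k' t|) + (∫ t, |t| * |k t|)) + (L₁ + L₂) * (∫ t, |t| * |k t|)) * SY))) ∧
    (∀ τ ∈ Icc b e, ‖Y τ - ∫ y : ℝ, ((k (τ - y) : ℝ) : ℂ) * Y y‖
        ≤ ((c - τ) / (c - e)) ^ p *
          ((((1 + b₂ / (2 * (2 * G / q))) / β₀) / (1 - b₂ / (2 * (2 * G / q)))) *
            ((β₀ * (((1 + b₂ / (2 * (2 * G / q))) / β₀) / (1 - b₂ / (2 * (2 * G / q))))) *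
              (G * (10 / (q * Real.sqrt (π * √q)) * Real.exp (-(X / 2)) * (1 + ∫ t, |k t|) * (∫ x : ℝ, ‖Y x‖ ^ 2) ^ (1 / 2 : ℝ))
                + ((1 + ∫ t, |k t|) * SL + Λ * ST
                  + (Λ₂ * ((∫ t, t ^ 2 * |k' t|) + (∫ t, |t| * |k t|)) + (L₁ + L₂) * (∫ t, |t| * |k t|)) * SY))))) := by
  have hkc : Continuous k := continuous_iff_continuousAt.2 fun t => (hk t).continuousAt
  have hβ₂c : Continuous β₂ := continuous_iff_continuousAt.2 fun t => (hβ₂ t).continuousAt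
  have hGq : 0 < 2 * G / q := by positivity
  have hb20 : 0 ≤ b₂ := (norm_nonneg _).trans (hb₂ 0)
  have hΛ0 : 0 ≤ Λ := (abs_nonneg _).trans (hΛ 0)
  have hc : c ∈ Icc b c := right_mem_Icc.2 (hbe.trans hec.le)
  -- the far piece, its derivative, the ODE and its forcing
  set z : ℝ → ℂ := fun x => Y x - ∫ y : ℝ, ((k (x - y) : ℝ) : ℂ) * Y y with hzdef
  set z' : ℝ → ℂ := fun x => deriv Y x - ∫ y : ℝ, ((k (x - y) : ℝ) : ℂ) * deriv Y y with hz'def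
  set f : ℝ → ℂ := fun x =>
    (-(I * (G : ℂ) * ∫ σ : ℝ, ((((2 * q - (x - σ) ^ 2) * (((x - σ) ^ 2 + q) ^ (5 / 2 : ℝ))⁻¹ : ℝ)) : ℂ)
              * (Y σ - ∫ y : ℝ, ((k (σ - y) : ℝ) : ℂ) * Y y))
        - (I * (G : ℂ) * ((2 / q : ℂ) * (Y x - ∫ y : ℝ, ((k (x - y) : ℝ) : ℂ) * Y y)
            - ∫ σ : ℝ, ((((2 * q - (x - σ) ^ 2) * (((x - σ) ^ 2 + q) ^ (5 / 2 : ℝ))⁻¹ : ℝ)) : ℂ)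
                * (Y σ - ∫ y : ℝ, ((k (σ - y) : ℝ) : ℂ) * Y y))
          - ((w x : ℝ) : ℂ) * (deriv Y x - ∫ y : ℝ, ((k (x - y) : ℝ) : ℂ) * deriv Y y)
          + β₁ x * (Y x - ∫ y : ℝ, ((k (x - y) : ℝ) : ℂ) * Y y) + β₂ x * conj (Y x - ∫ y : ℝ, ((k (x - y) : ℝ) : ℂ) * Y y))) with hfdef
  have hz : ∀ τ ∈ Icc b c, HasDerivAt z (z' τ) τ := fun τ _ => hasDerivAt_far hkc hY hYs τ
  have hode : ∀ τ ∈ Icc b c, (w τ : ℂ) * z' τ = I * ((2 * G / q : ℝ) : ℂ) * z τ + β₁ τ * z τ + β₂ τ * conj (z τ) + f τ :=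
    fun τ _ => far_transport_ode q G hq k Y w β₁ β₂ τ
  set MH : ℝ := G * (10 / (q * Real.sqrt (π * √q)) * Real.exp (-(X / 2)) * (1 + ∫ t, |k t|) * (∫ x : ℝ, ‖Y x‖ ^ 2) ^ (1 / 2 : ℝ))
        + ((1 + ∫ t, |k t|) * SL + Λ * ST
          + (Λ₂ * ((∫ t, t ^ 2 * |k' t|) + (∫ t, |t| * |k t|)) + (L₁ + L₂) * (∫ t, |t| * |k t|)) * SY) with hMH
  have hf : ∀ τ ∈ Icc b c, ‖f τ‖ ≤ MH := fun τ hτ =>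
    norm_far_forcing_le_sup hq hG hX hk hk'c hki hk1 hk'2 hkM hkχ hfar hY hYs hw hw2 hΛ hΛ₂ hβ₁c hβ₂c hb₁ hb₂ hL₁ hL₂ hSL hSY (hST τ hτ)
  have hMH0 : 0 ≤ MH := (norm_nonneg _).trans (hf c hc)
  -- the two-zone chain (left) with rotation rate `2G/q`
  have hwneg' : ∀ τ ∈ Ico b c, w τ < 0 := fun τ hτ => hwneg τ ⟨hτ.1, hτ.2.le⟩ hτ.2
  have h := twoZone_norm_le_var_left (z := z) (z' := z') (f := f) (α := β₁) (β := β₂) (β' := β₂') (G := 2 * G / q) (βmax := b₂)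
    hGq hMH0 hβ₀ hb20 hec hbe hw₁ hp0 hz (fun τ _ => hβ₂ τ) hw.continuous hwc hwneg' hww₁ hode hf (fun τ _ => hb₂ τ) hsmall
    hgain hstag hgrow
  exact h

end Summit.NavierStokesRegularity.NavierStokesRegularity.Theorems.MatchedKernel

end
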